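import Mathlib.Analysis.SpecialFunctions.SmoothTransition
import Mathlib.Analysis.Calculus.Deriv.Slope
import Mathlib.Geometry.Manifold.MFDeriv.NormedSpace
import Mathlib.Geometry.Manifold.ContMDiff.NormedSpace
import Mathlib.Geometry.Manifold.MFDeriv.SpecificFunctions
import HarnessLib

/-!
# A monotone cut-off across a shell `{ε ≤ r ≤ 2ε}` of a function smooth on an open set

Topic `Literature/Geometry/Manifold`.  The cut-off function of McLean's Stokes argument for the
sign of the wrapping number (M. McLean, GAFA 22 (2012), Lemma 5.17; fact seat of
`Literature.Geometry.Symplectic.mclean_divisorComplement_convex_four`): given a function `r`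
smooth on an open set `V` of a manifold (the squared radius of a tube, smooth off nothing but
defined near the divisor only) such that the "solid shell" `{x ∈ V | r x ≤ 2ε}` is closed in `M`,
there is a smooth `χ : M → ℝ` with `χ = 0` where `r ≤ ε` (on `V`), `χ = 1` off `V` and where
`r ≥ 2ε`, `χ ≥ 0`, together with a smooth `g ≥ 0` supported in the shell `{ε ≤ r ≤ 2ε} ∩ V`
with `dχ = g · dr` on `V`, `dχ = 0` off `V`, and `g · r` smooth (`exists_shell_cutoff`).
Construction: `χ = φ ∘ r` on `V`, `1` off `V`, with `φ(t) = smoothTransition ((t - ε)/ε)`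
(Mathlib), which is monotone, so `g = φ' ∘ r ≥ 0` (`HasDerivAt.nonneg_of_monotone`).

Everything is proved; no definitions, no named facts (D-0026).

## References

* M. McLean, *The growth rate of symplectic homology and affine varieties*, GAFA 22 (2012),
  Lemma 5.17. [Mclean2012]
-/

noncomputable section

open scoped Manifold ContDiff Topology
open Set Function Filter

namespace Literature.Geometry.Manifold

/-- The profile `φ(t) = smoothTransition ((t - ε)/ε)`: smooth, `0` on `(-∞, ε]`, `1` on
`[2ε, ∞)`, monotone; its derivative is `≥ 0`, vanishes off `[ε, 2ε]`, and is smooth. [folklore] -/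
theorem shellProfile_props {ε : ℝ} (hε : 0 < ε) :
    ∃ φ : ℝ → ℝ, ContDiff ℝ ∞ φ ∧ ContDiff ℝ ∞ (deriv φ) ∧ (∀ t, t ≤ ε → φ t = 0) ∧
      (∀ t, 2 * ε ≤ t → φ t = 1) ∧ (∀ t, 0 ≤ φ t) ∧ (∀ t, 0 ≤ deriv φ t) ∧
      (∀ t, t < ε → deriv φ t = 0) ∧ (∀ t, 2 * ε < t → deriv φ t = 0) := by
  set φ : ℝ → ℝ := fun t ↦ Real.smoothTransition ((t - ε) / ε) with hφ_def
  have hφ : ContDiff ℝ ∞ φ :=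
    Real.smoothTransition.contDiff.comp ((contDiff_id.sub contDiff_const).div_const ε)
  have h0 : ∀ t, t ≤ ε → φ t = 0 := fun t ht ↦
    Real.smoothTransition.zero_of_nonpos (div_nonpos_of_nonpos_of_nonneg (sub_nonpos.2 ht) hε.le)
  have h1 : ∀ t, 2 * ε ≤ t → φ t = 1 := fun t ht ↦
    Real.smoothTransition.one_of_one_le ((one_le_div hε).2 (by linarith))
  have hmono : Monotone φ := fun a b hab ↦
    Real.smoothTransition.monotone (div_le_div_of_nonneg_right (sub_le_sub_right hab ε) hε.le)
  have hdiff : Differentiable ℝ φ := hφ.differentiable (by simp)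
  have hd0 : ∀ t, t < ε → deriv φ t = 0 := by
    intro t ht
    have hev : φ =ᶠ[𝓝 t] fun _ ↦ (0 : ℝ) := by
      filter_upwards [Iio_mem_nhds ht] with u hu
      exact h0 u (le_of_lt hu)
    rw [hev.deriv_eq, deriv_const]
  have hd1 : ∀ t, 2 * ε < t → deriv φ t = 0 := by
    intro t ht
    have hev : φ =ᶠ[𝓝 t] fun _ ↦ (1 : ℝ) := by
      filter_upwards [Ioi_mem_nhds ht] with u hu
      exact h1 u (le_of_lt hu)
    rw [hev.deriv_eq, deriv_const]
  refine ⟨φ, hφ, (contDiff_infty_iff_deriv.1 hφ).2, h0, h1, fun t ↦ Real.smoothTransition.nonneg _,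
    fun t ↦ (hdiff t).hasDerivAt.nonneg_of_monotone hmono, hd0, hd1⟩

variable {E : Type*} [NormedAddCommGroup E] [NormedSpace ℝ E] {H : Type*} [TopologicalSpace H]
  {I : ModelWithCorners ℝ E H} {M : Type*} [TopologicalSpace M] [ChartedSpace H M]

/-- **Monotone cut-off across a shell.**  For `r` smooth on an open `V` with closed solid shell
`{x ∈ V | r x ≤ 2ε}`: a smooth `χ` (`= 0` where `r ≤ ε` on `V`, `= 1` off `V` and where
`r ≥ 2ε`, `χ ≥ 0`) and a smooth `g ≥ 0` supported in the shell, with `dχ = g dr` on `V`,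
`dχ = 0` off `V`, and `g · r` smooth (McLean (2012), proof of Lemma 5.17: the cut-off `χ(r²)`).
[cite: Mclean2012, Lemma 5.17 (proof)] -/
theorem exists_shell_cutoff (r : M → ℝ) {V : Set M} (hV : IsOpen V)
    (hr : ∀ x ∈ V, ContMDiffAt I 𝓘(ℝ, ℝ) ∞ r x) {ε : ℝ} (hε : 0 < ε)
    (hK : IsClosed {x | x ∈ V ∧ r x ≤ 2 * ε}) :
    ∃ χ g : M → ℝ,
      ContMDiff I 𝓘(ℝ, ℝ) ∞ χ ∧ ContMDiff I 𝓘(ℝ, ℝ) ∞ g ∧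
      ContMDiff I 𝓘(ℝ, ℝ) ∞ (fun x ↦ g x * r x) ∧
      (∀ x, 0 ≤ χ x) ∧ (∀ x, 0 ≤ g x) ∧
      (∀ x ∈ V, r x ≤ ε → χ x = 0) ∧
      (∀ x, (x ∈ V → 2 * ε ≤ r x) → χ x = 1) ∧
      (∀ x, g x ≠ 0 → x ∈ V ∧ ε ≤ r x ∧ r x ≤ 2 * ε) ∧
      (∀ x ∈ V, mfderiv I 𝓘(ℝ, ℝ) χ x = g x • mfderiv I 𝓘(ℝ, ℝ) r x) ∧
      (∀ x ∉ V, mfderiv I 𝓘(ℝ, ℝ) χ x = 0) := by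
  classical
  obtain ⟨φ, hφ, hdφ, h0, h1, hφnn, hdnn, hd0, hd1⟩ := shellProfile_props hε
  set χ : M → ℝ := fun x ↦ if x ∈ V then φ (r x) else 1 with hχ
  set g : M → ℝ := fun x ↦ if x ∈ V then deriv φ (r x) else 0 with hg
  -- local descriptions
  have hχV : ∀ x ∈ V, χ =ᶠ[𝓝 x] fun y ↦ φ (r y) := fun x hx ↦ by
    filter_upwards [hV.mem_nhds hx] with y hy
    simp [hχ, hy]
  have hgV : ∀ x ∈ V, g =ᶠ[𝓝 x] fun y ↦ deriv φ (r y) := fun x hx ↦ by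
    filter_upwards [hV.mem_nhds hx] with y hy
    simp [hg, hy]
  have hKc : ∀ x ∉ V, {y | y ∈ V ∧ r y ≤ 2 * ε}ᶜ ∈ 𝓝 x := fun x hx ↦
    hK.isOpen_compl.mem_nhds fun h ↦ hx h.1
  have hχout : ∀ x ∉ V, χ =ᶠ[𝓝 x] fun _ ↦ (1 : ℝ) := fun x hx ↦ by
    filter_upwards [hKc x hx] with y hy
    by_cases hyV : y ∈ V
    · have hry : 2 * ε < r y := by
        by_contra hle
        exact hy ⟨hyV, not_lt.1 hle⟩
      simp [hχ, hyV, h1 _ hry.le]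
    · simp [hχ, hyV]
  have hgout : ∀ x ∉ V, g =ᶠ[𝓝 x] fun _ ↦ (0 : ℝ) := fun x hx ↦ by
    filter_upwards [hKc x hx] with y hy
    by_cases hyV : y ∈ V
    · have hry : 2 * ε < r y := by
        by_contra hle
        exact hy ⟨hyV, not_lt.1 hle⟩
      simp [hg, hyV, hd1 _ hry]
    · simp [hg, hyV]
  have hgrout : ∀ x ∉ V, (fun y ↦ g y * r y) =ᶠ[𝓝 x] fun _ ↦ (0 : ℝ) := fun x hx ↦ by
    filter_upwards [hgout x hx] with y hy
    simp [hy]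
  -- smoothness
  have hχs : ContMDiff I 𝓘(ℝ, ℝ) ∞ χ := by
    intro x
    by_cases hx : x ∈ V
    · exact ((hφ.contDiffAt).comp_contMDiffAt (hr x hx)).congr_of_eventuallyEq (hχV x hx)
    · exact contMDiffAt_const.congr_of_eventuallyEq (hχout x hx)
  have hgs : ContMDiff I 𝓘(ℝ, ℝ) ∞ g := by
    intro x
    by_cases hx : x ∈ V
    · exact ((hdφ.contDiffAt).comp_contMDiffAt (hr x hx)).congr_of_eventuallyEq (hgV x hx)
    · exact contMDiffAt_const.congr_of_eventuallyEq (hgout x hx)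
  have hgrs : ContMDiff I 𝓘(ℝ, ℝ) ∞ (fun x ↦ g x * r x) := by
    intro x
    by_cases hx : x ∈ V
    · have hp : ContMDiffAt I 𝓘(ℝ, ℝ × ℝ) ∞ (fun y ↦ (g y, r y)) x :=
        (hgs x).prodMk_space (hr x hx)
      exact contDiff_mul.comp_contMDiffAt hp
    · exact contMDiffAt_const.congr_of_eventuallyEq (hgrout x hx)
  refine ⟨χ, g, hχs, hgs, hgrs, fun x ↦ ?_, fun x ↦ ?_, fun x hx hrx ↦ ?_, fun x hx ↦ ?_,
    fun x hgx ↦ ?_, fun x hx ↦ ?_, fun x hx ↦ ?_⟩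
  · by_cases hx : x ∈ V <;> simp [hχ, hx, hφnn]
  · by_cases hx : x ∈ V <;> simp [hg, hx, hdnn]
  · simp [hχ, hx, h0 _ hrx]
  · by_cases hxV : x ∈ V
    · simp [hχ, hxV, h1 _ (hx hxV)]
    · simp [hχ, hxV]
  · by_cases hxV : x ∈ V
    · have hgx' : deriv φ (r x) ≠ 0 := by simpa [hg, hxV] using hgx
      refine ⟨hxV, ?_, ?_⟩
      · by_contra hlt
        exact hgx' (hd0 _ (not_le.1 hlt))
      · by_contra hlt
        exact hgx' (hd1 _ (not_le.1 hlt))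
    · exact absurd (by simp [hg, hxV]) hgx
  · -- chain rule on `V`
    have hrx : HasMFDerivAt I 𝓘(ℝ, ℝ) r x (mfderiv I 𝓘(ℝ, ℝ) r x) :=
      ((hr x hx).mdifferentiableAt (by simp)).hasMFDerivAt
    have hφx : HasMFDerivAt 𝓘(ℝ, ℝ) 𝓘(ℝ, ℝ) φ (r x)
        (ContinuousLinearMap.smulRight (1 : ℝ →L[ℝ] ℝ) (deriv φ (r x))) :=
      ((hφ.differentiable (by simp)) (r x)).hasDerivAt.hasFDerivAt.hasMFDerivAt
    have hcomp := (hφx.comp x hrx).mfderiv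
    rw [(hχV x hx).mfderiv_eq, show (fun y ↦ φ (r y)) = φ ∘ r from rfl, hcomp]
    refine ContinuousLinearMap.ext fun w ↦ ?_
    show @id ℝ (mfderiv I 𝓘(ℝ, ℝ) r x w) * deriv φ (r x) = g x * @id ℝ (mfderiv I 𝓘(ℝ, ℝ) r x w)
    simp only [hg, if_pos hx]
    exact mul_comm _ _
  · rw [(hχout x hx).mfderiv_eq]
    exact mfderiv_const

end Literature.Geometry.Manifold
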